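import Summits.CriticalPhenomena.CardyFormulaZ2.Theorems.CardyMagicRigidityNestingRigidityBigLoopsExpMomentBKT
import Summits.CriticalPhenomena.CardyFormulaZ2.Theorems.CardyMagicRigidityNestingRigidityTowerMomentUpperZ2
import HarnessLib

/-!
# A-priori polynomial UPPER bound on the tower moments, V: site-`𝕋`, and both lattices
# (helper [B-up] of line `positive-cone-weight-doubling`, crux `NestingRigidity`)

Crux `Summit.CriticalPhenomena.CardyFormulaZ2.Theses.CardyMagicRigidity.NestingRigidity`
(stmt-CriticalPhenomena-4835), line `positive-cone-weight-doubling`.  This file closes the registered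
helper [B-up] `towerMoment_upper_latticeEnsembles` toward the shared stub `stub_uvDecoupling` (the
Hölder reduction [C] `uvDecoupling_of_untilted_bounds` needs, for EVERY weight `w > 0`, an a-priori
bound `E_δ[w ^ N_0(r,1)] ≤ r ^ (-C)` for all small `r` and then all small meshes): weights `w ≤ 1` are
trivial (`TowerMomentUpper.towerMoment_le_one`, `C = 0`), the bond-`ℤ²` half for `w > 1` is
`TowerMomentUpper.towerMoment_le_rpow_zEns` (`…TowerMomentUpperZ2`), and the site-`𝕋` half for
`w ≥ 1` is proved here: `E_δ[w ^ N_0(r,1)] ≤ r ^ (-C)` for `0 < δ`, `c₀ δ ≤ r ≤ 1/2` — the same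
thin-cells argument as on bond-`ℤ²` (`…TowerMomentUpperZ2`), with the Bollobás–Riordan annulus
bound `tri_annulusCrossing_bound_holds` for confined arms (`real_triArm_le`), the joint disjoint
occurrence of confined arms witnessed by the open left clusters of the counter-clockwise loops
(`BigLoopsExp.mem_foldr_triArm_of_typeOne_families`, `…BigLoopsExpMomentBKT`), the colour flip
`ω ↦ ωᶜ` for the clockwise ones (`…_compl_of_typeZero_families`,
`BigLoopsExp.measure_preimage_compl_le`), and van den Berg–Kesten `sitePercolation_bk` iterated by
`BigLoopsExp.measureReal_foldr_ofFn_le_prod`: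
* §1 `exists_patterns_tEns` (pointwise: the two occupation patterns, `N ≤ ∑ m₀ + ∑ m₁`);
* §2 `pattern_bound_tEns`, `crossing_le_tEns` (one BK product, RSW in a cell of aspect ratio `K`);
* §3 `towerMoment_le_rpow_tEns` (`E_δ[w^N] ≤ 2^B ≤ r^{-4(8K+1)²}`);
* §4 the registered statement `towerMoment_upper_latticeEnsembles` (`r₀ = 1/2`; `r₀ = 1`, `C = 0`
  for `w ≤ 1`).
-/

noncomputable section

open MeasureTheory Set Filter Metric
open scoped Real Topology BigOperators ENNReal

namespace Summit.CriticalPhenomena.CardyFormulaZ2.Cruxes.NestingRigidity.PositiveConeWeightDoubling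

open Literature.Probability.RandomPlanarGeometry Literature.Probability.Percolation
  Literature.Probability.LatticeModels
open Summit.CriticalPhenomena.CardyFormulaZ2.Cruxes.NestingRigidity.RingCloudTomography

namespace TowerMomentUpper

/-! ## §1 Pointwise: the two occupation patterns of a site configuration -/

/-- **The occupation patterns of the tower on site-`𝕋`.**  For a site configuration `ω` at mesh
`δ > 0`, cells `(c i, a i)` covering `r/2 < ‖z‖ < 2` with `K a i ≤ ‖c i‖` and `a i + 5δ ≤ K a i`, and
a bound `M` on the number of loops meeting `B̄(0, 1)`: there are patterns `m₀, m₁ : Fin B → Fin (M+1)`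
with `N_0(r,1) ≤ ∑ m₀ + ∑ m₁`, `ω` in the joint disjoint occurrence of `m₁ i` confined open arms
across `A(c i; a i + 3δ, K a i - 2δ)` and `ωᶜ` in that of `m₀ i` such arms (the counter-clockwise,
resp. clockwise, loops of the tower sorted into the cells). -/
theorem exists_patterns_tEns (ω : SiteConfig (Site 2)) {δ : ℝ} (hδ : 0 < δ) {r : ℝ} (hr : 0 < r)
    (hr2 : r < 2) {M : ℕ}
    (hM : {u ∈ (tEns.X δ ω).loops | (u.range ∩ closedBall (0 : ℂ) 1).Nonempty}.Finite ∧
      {u ∈ (tEns.X δ ω).loops | (u.range ∩ closedBall (0 : ℂ) 1).Nonempty}.ncard ≤ M)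
    {B : ℕ} {K : ℝ} (c : Fin B → ℂ) (a : Fin B → ℝ)
    (hcov : ∀ z : ℂ, r / 2 < ‖z‖ → ‖z‖ < 2 → ∃ i, dist z (c i) ≤ a i ∧ K * a i ≤ ‖c i‖)
    (hab : ∀ i, a i + 5 * δ ≤ K * a i) :
    ∃ m₀ m₁ : Fin B → Fin (M + 1),
      towerCount (tEns.X δ ω) 0 r 1 ≤ ∑ i, (m₀ i : ℕ) + ∑ i, (m₁ i : ℕ) ∧
      ωᶜ ∈ (List.ofFn fun i ↦ disjointOccurrencePow
        (triArm δ (c i) (a i + 3 * δ) (K * a i - 2 * δ)) (m₀ i : ℕ)).foldr disjointOccurrence univ ∧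
      ω ∈ (List.ofFn fun i ↦ disjointOccurrencePow
        (triArm δ (c i) (a i + 3 * δ) (K * a i - 2 * δ)) (m₁ i : ℕ)).foldr disjointOccurrence univ := by
  -- the typed towers
  set S : Fin 2 → Set (UnbasedLoop ℂ) := fun t ↦ {u ∈ (siteLoopConfig δ ω).F t |
    closedBall (0 : ℂ) r ⊆ {z | u.wind z ≠ 0} ∧ u.range ⊆ ball (0 : ℂ) 1} with hS
  have hSsub : ∀ t, S t ⊆ {u ∈ (tEns.X δ ω).loops | (u.range ∩ closedBall (0 : ℂ) 1).Nonempty} := by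
    rintro t u ⟨hu, hwind, hrange⟩
    refine ⟨?_, ?_⟩
    · change u ∈ (siteLoopConfig δ ω).loops
      rw [LoopConfig.mem_loops_iff]
      fin_cases t
      · exact Or.inl hu
      · exact Or.inr hu
    · obtain ⟨z, hz, -, hz1⟩ := exists_mem_range_norm u hwind hrange
      exact ⟨z, hz, mem_closedBall_zero_iff.2 hz1.le⟩
  have hSfin : ∀ t, (S t).Finite := fun t ↦ hM.1.subset (hSsub t)
  have hSM : ∀ t, (S t).ncard ≤ M := fun t ↦ (Set.ncard_le_ncard (hSsub t) hM.1).trans hM.2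
  have htower : ∀ t, ∀ u ∈ S t, closedBall (0 : ℂ) r ⊆ {z | u.wind z ≠ 0} ∧ u.range ⊆ ball (0 : ℂ) 1 :=
    fun t u hu ↦ hu.2
  -- the tower count splits by type
  have hcount : towerCount (tEns.X δ ω) 0 r 1 ≤ (S 0).ncard + (S 1).ncard := by
    have heq : {u ∈ (tEns.X δ ω).loops |
        closedBall (0 : ℂ) r ⊆ {z | u.wind z ≠ 0} ∧ u.range ⊆ ball (0 : ℂ) 1} = S 0 ∪ S 1 := by
      ext u
      simp only [hS, Set.mem_setOf_eq, Set.mem_union]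
      change (u ∈ (siteLoopConfig δ ω).loops ∧ _) ↔ _
      rw [LoopConfig.mem_loops_iff]
      tauto
    unfold towerCount
    rw [heq]
    exact Set.ncard_union_le _ _
  -- sort both typed towers into the cells
  obtain ⟨T₀, m₀, hT₀S, hT₀fin, hT₀disj, hmeet₀, hm₀, hsum₀⟩ :=
    exists_families (hSfin 0) (hSM 0) hr.le hr2 (htower 0) c a hcov
  obtain ⟨T₁, m₁, hT₁S, hT₁fin, hT₁disj, hmeet₁, hm₁, hsum₁⟩ :=
    exists_families (hSfin 1) (hSM 1) hr.le hr2 (htower 1) c a hcov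
  refine ⟨m₀, m₁, ?_, ?_, ?_⟩
  · rw [hsum₀, hsum₁]; exact hcount
  · exact BigLoopsExp.mem_foldr_triArm_compl_of_typeZero_families hδ (b := fun i ↦ K * a i) hab c T₀
      (fun i u hu ↦ (hT₀S i hu).1) hT₀fin hT₀disj hmeet₀ (fun i ↦ (m₀ i : ℕ)) fun i ↦ (hm₀ i).le
  · exact BigLoopsExp.mem_foldr_triArm_of_typeOne_families hδ (b := fun i ↦ K * a i) hab c T₁
      (fun i u hu ↦ (hT₁S i hu).1) hT₁fin hT₁disj hmeet₁ (fun i ↦ (m₁ i : ℕ)) fun i ↦ (hm₁ i).le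

/-! ## §2 The pattern events: cylinder events, one BK product, RSW -/

/-- **One van den Berg–Kesten product over all cells (site-`𝕋`).**  The joint disjoint occurrence of
`k i` confined open arms across the annuli `A(x i; a i, b i)` is a cylinder event of probability
`≤ ∏ i, p ^ (k i)` whenever every single arm event has probability `≤ p` (BK `sitePercolation_bk`
iterated by `BigLoopsExp.measureReal_foldr_ofFn_le_prod` over a common finite set of sites). -/
theorem pattern_bound_tEns {δ : ℝ} (hδ : 0 < δ) {B : ℕ} (x : Fin B → ℂ) (a b : Fin B → ℝ) {p : ℝ}
    (hp : ∀ i, (triSitePercolation half).real (triArm δ (x i) (a i) (b i)) ≤ p) (k : Fin B → ℕ) :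
    MeasurableSet ((List.ofFn fun i ↦ disjointOccurrencePow (triArm δ (x i) (a i) (b i))
      (k i)).foldr disjointOccurrence univ) ∧
    (triSitePercolation half).real ((List.ofFn fun i ↦ disjointOccurrencePow
      (triArm δ (x i) (a i) (b i)) (k i)).foldr disjointOccurrence univ) ≤ ∏ i, p ^ (k i) := by
  classical
  -- a common finite determining set of sites
  set G : Fin B → Finset (Site 2) := fun i ↦
    (finite_setOf_dist_triMeshPoint_le hδ (x i) (b i + 2 * δ)).toFinset with hG
  set F : Finset (Site 2) := Finset.univ.sup G with hF
  have hAF : ∀ i, DeterminedBy (triArm δ (x i) (a i) (b i)) ↑F := fun i ↦ by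
    refine (determinedBy_triArm δ (x i) (a i) (b i)).mono ?_
    rw [← (finite_setOf_dist_triMeshPoint_le hδ (x i) (b i + 2 * δ)).coe_toFinset]
    exact Finset.coe_subset.2 (Finset.le_sup (f := G) (Finset.mem_univ i))
  have hA : ∀ i, IsUpperSet (triArm δ (x i) (a i) (b i)) := fun i ↦ isUpperSet_triArm _ _ _ _
  have hdet := BigLoopsExp.determinedBy_foldr (BigLoopsExp.determinedBy_of_mem_ofFn hAF k)
  refine ⟨hdet.measurableSet_of_finset, ?_⟩
  have hBK : ∀ A' B' : Set (Set (Site 2)), IsUpperSet A' → IsUpperSet B' →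
      DeterminedBy A' ↑F → DeterminedBy B' ↑F →
      (triSitePercolation half).real (A' □ B') ≤
        (triSitePercolation half).real A' * (triSitePercolation half).real B' :=
    fun A' B' hA' hB' hA'F hB'F ↦ sitePercolation_bk half hA'F hB'F hA' hB'
  refine (BigLoopsExp.measureReal_foldr_ofFn_le_prod (triSitePercolation half) hBK _ k hA hAF).trans ?_
  exact Finset.prod_le_prod (fun i _ ↦ pow_nonneg measureReal_nonneg _) fun i _ ↦
    pow_le_pow_left₀ measureReal_nonneg (hp i) _

/-- **RSW in a cell of aspect ratio `K ≥ 8` (site-`𝕋`)**: with the exponent `α` of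
`tri_annulusCrossing_bound_holds`, the confined open arm across `A(x; a + 3δ, K a - 2δ)` has
probability `≤ (4/K)^α` as soon as `1000 δ ≤ a` (`real_triArm_le`). -/
theorem crossing_le_tEns {α : ℝ} (hα : 0 < α)
    (hbd : ∀ (b : Bool) (δ : ℝ) (z : ℂ) (r₁ r₂ : ℝ), 0 < δ → 1000 * δ ≤ r₁ → 2 * r₁ ≤ r₂ →
      (triSitePercolation half).real (triAnnulusCrossing b δ z r₁ r₂) ≤ (r₁ / r₂) ^ α)
    {K : ℝ} (hK : 8 ≤ K) {δ a : ℝ} (hδ : 0 < δ) (ha : 1000 * δ ≤ a) (x : ℂ) :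
    (triSitePercolation half).real (triArm δ x (a + 3 * δ) (K * a - 2 * δ)) ≤ (4 / K) ^ α := by
  have ha0 : 0 < a := by linarith
  have hKa : 8 * a ≤ K * a := mul_le_mul_of_nonneg_right hK ha0.le
  have h1 := real_triArm_le hbd hδ x (r := a + 3 * δ) (R := K * a - 2 * δ) (by linarith) (by linarith)
  refine h1.trans (Real.rpow_le_rpow (div_nonneg (by linarith) (by linarith)) ?_ hα.le)
  rw [div_le_div_iff₀ (by linarith) (by linarith)]
  nlinarith

/-! ## §3 The bound on site-`𝕋` -/

/-- **A-priori polynomial upper bound on the tower moments of site-`𝕋`, weights `w ≥ 1`.**  There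
are `C` and `c₀ > 0` such that `E_δ[w ^ N_0(r,1)] ≤ r ^ (-C)` for all `0 < δ`, `c₀ δ ≤ r ≤ 1/2`
(`C = 4(8K+1)²` with the aspect ratio `K` of `exists_aspect`). -/
theorem towerMoment_le_rpow_tEns {w : ℝ} (hw : 1 ≤ w) : ∃ C c₀ : ℝ, 0 < c₀ ∧
    ∀ r δ : ℝ, 0 < δ → c₀ * δ ≤ r → r ≤ 1 / 2 → tEns.towerMoment w δ r ≤ r ^ (-C) := by
  haveI := isProbabilityMeasure_of_mem tEns_mem
  obtain ⟨α, hα, hbd⟩ := tri_annulusCrossing_bound_holds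
  obtain ⟨K, hK8, hKw⟩ := exists_aspect hw hα
  have hK1 : 1 ≤ K := by omega
  have hK8' : (8 : ℝ) ≤ K := by exact_mod_cast hK8
  have hK0 : (0 : ℝ) < K := by linarith
  refine ⟨4 * (8 * K + 1) ^ 2, 8 * K * 1000, by positivity, fun r δ hδ hδr hr2 ↦ ?_⟩
  have hr : 0 < r := lt_of_lt_of_le (by positivity) hδr
  obtain ⟨B, c, a, hB, ha, hcov⟩ := exists_cells hK1 hr hr2
  -- mesh conditions in every cell
  have hmesh : ∀ i, 1000 * δ ≤ a i := fun i ↦ by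
    have h1 := (ha i).1
    have h2 : 1000 * δ ≤ r / (8 * K) := by
      rw [le_div_iff₀ (by positivity)]; linarith
    linarith
  have hab : ∀ i, a i + 5 * δ ≤ (K : ℝ) * a i := fun i ↦ by
    have := hmesh i
    have ha0 : 0 ≤ a i := by linarith
    nlinarith [mul_le_mul_of_nonneg_right hK8' ha0]
  obtain ⟨M, hM⟩ := FirstMoment.exists_ncard_loops_meeting_le tEns tEns_mem hδ 1
  -- the single-cell arm probability
  have hp : ∀ (x : ℂ) (i : Fin B), (triSitePercolation half).real
      (triArm δ x (a i + 3 * δ) (K * a i - 2 * δ)) ≤ ((4 : ℝ) / K) ^ α := fun x i ↦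
    crossing_le_tEns hα hbd hK8' hδ (hmesh i) x
  -- the two families of pattern events
  set D₁ : (Fin B → Fin (M + 1)) → Set (SiteConfig (Site 2)) := fun m ↦
    (List.ofFn fun i ↦ disjointOccurrencePow (triArm δ (c i) (a i + 3 * δ) (K * a i - 2 * δ))
      (m i : ℕ)).foldr disjointOccurrence univ with hD₁
  set D₀ : (Fin B → Fin (M + 1)) → Set (SiteConfig (Site 2)) := fun m ↦ compl ⁻¹'
    (List.ofFn fun i ↦ disjointOccurrencePow (triArm δ (c i) (a i + 3 * δ) (K * a i - 2 * δ))
      (m i : ℕ)).foldr disjointOccurrence univ with hD₀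
  have h₁ : ∀ m, MeasurableSet (D₁ m) ∧ tEns.P.real (D₁ m) ≤ ∏ i, (((4 : ℝ) / K) ^ α) ^ (m i : ℕ) :=
    fun m ↦ pattern_bound_tEns hδ c (fun i ↦ a i + 3 * δ) (fun i ↦ K * a i - 2 * δ)
      (fun i ↦ hp (c i) i) fun i ↦ (m i : ℕ)
  have h₀ : ∀ m, MeasurableSet (D₀ m) ∧ tEns.P.real (D₀ m) ≤ ∏ i, (((4 : ℝ) / K) ^ α) ^ (m i : ℕ) := by
    intro m
    obtain ⟨hmeas, hle⟩ := h₁ m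
    exact ⟨measurableSet_preimage measurable_compl hmeas,
      (ENNReal.toReal_mono (measure_ne_top _ _)
        (BigLoopsExp.measure_preimage_compl_le _)).trans hle⟩
  have key := integral_pow_le_two_pow tEns.P D₀ D₁ (fun m ↦ (h₀ m).1) (fun m ↦ (h₁ m).1)
    (p := ((4 : ℝ) / K) ^ α) (by positivity) hw hKw (fun m ↦ (h₀ m).2) (fun m ↦ (h₁ m).2)
    (fun ω ↦ towerCount (tEns.X δ ω) 0 r 1)
    (Eventually.of_forall fun ω ↦ exists_patterns_tEns ω hδ hr (by linarith) (hM ω) c a hcov hab)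
  calc tEns.towerMoment w δ r = ∫ ω, w ^ towerCount (tEns.X δ ω) 0 r 1 ∂tEns.P := rfl
    _ ≤ 2 ^ B := key
    _ ≤ r ^ (-(4 * (8 * (K : ℝ) + 1) ^ 2)) := two_pow_le_rpow_neg hr hB

end TowerMomentUpper

/-! ## §4 [B-up]: both lattice ensembles, every weight -/

/-- **[B-up] A-priori polynomial UPPER bound on the positively weighted tower moments, both
lattices** (registered helper toward the shared stub `stub_uvDecoupling`, line
`positive-cone-weight-doubling`).  For `E ∈ latticeEnsembles` and every weight `w > 0` there are `C`
and `r₀ > 0` such that for every `r ∈ (0, r₀)`, for all small meshes `δ`,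
`E_δ[w ^ N_0(r,1)] ≤ r ^ (-C)`: trivial for `w ≤ 1` (`E_δ[w^N] ≤ 1 = r^0`,
`TowerMomentUpper.towerMoment_le_one`); for `w > 1` the thin-cells / one-BK-product bounds
`TowerMomentUpper.towerMoment_le_rpow_zEns` (bond-`ℤ²`) and `TowerMomentUpper.towerMoment_le_rpow_tEns`
(site-`𝕋`), valid for `c₀ δ ≤ r ≤ 1/2`, read along `δ → 0⁺` (`TowerMomentUpper.eventually_mesh_le`). -/
theorem towerMoment_upper_latticeEnsembles : ∀ E ∈ latticeEnsembles, ∀ w : ℝ, 0 < w → ∃ C r₀ : ℝ, 0 < r₀ ∧ ∀ r ∈ Set.Ioo (0 : ℝ) r₀, ∀ᶠ δ in 𝓝[>] (0 : ℝ), E.towerMoment w δ r ≤ r ^ (-C) := by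
  intro E hE w hw
  rcases le_or_gt w 1 with hw1 | hw1
  · refine ⟨0, 1, one_pos, fun r _ ↦ Eventually.of_forall fun δ ↦ ?_⟩
    rw [neg_zero, Real.rpow_zero]
    exact TowerMomentUpper.towerMoment_le_one E hE hw.le hw1 δ r
  · have hmain : ∃ C c₀ : ℝ, 0 < c₀ ∧ ∀ r δ : ℝ, 0 < δ → c₀ * δ ≤ r → r ≤ 1 / 2 →
        E.towerMoment w δ r ≤ r ^ (-C) := by
      simp only [latticeEnsembles, Set.mem_insert_iff, Set.mem_singleton_iff] at hE
      rcases hE with rfl | rfl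
      · exact TowerMomentUpper.towerMoment_le_rpow_zEns hw1.le
      · exact TowerMomentUpper.towerMoment_le_rpow_tEns hw1.le
    obtain ⟨C, c₀, hc₀, h⟩ := hmain
    refine ⟨C, 1 / 2, by norm_num, fun r hr ↦ ?_⟩
    filter_upwards [TowerMomentUpper.eventually_mesh_le hc₀ hr.1] with δ hδ
    exact h r δ hδ.1 hδ.2 hr.2.le

end Summit.CriticalPhenomena.CardyFormulaZ2.Cruxes.NestingRigidity.PositiveConeWeightDoubling

end
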